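import Literature.NumberTheory.GaloisCohomology.Howard2004.ResidualTauCohomologyProofs
import HarnessLib

/-!
# Howard 2004, §1.5: the action of `τ` on `H¹(K_λ, T̄)` at an INERT prime `λ = λ̄` (place-datum
# bookkeeping; theorems only)

Topic `NumberTheory/GaloisCohomology/Howard2004`. THEOREMS ONLY: no definition, no named fact, no
instance, no notation, no `sorry`. Cell `pub/bsd-print-x9`, print leaf G87
`Literature.NumberTheory.GaloisCohomology.Howard2004.thm161_dvrKolyvaginBound`; seat `bsd-line-x10b-p1-w5`
g7 (input [EIG-LOC] of the Lemma 1.5.3 chain, see `EigenSelmerParityProofs`).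

SOURCE. B. Howard, Compositio Math. **140** (2004) = arXiv:1202.6340, §1.3 «conjugation by `τ` induces
an isomorphism `H^i(K_v̄, T) ≅ H^i(K_v, Tw(T))` where `v̄ = v^τ`» (p. 7 L44–48) and Lemma 1.5.3 (p. 10
L12–40), where at a degree-two prime `ℓ` of `K` (so `ℓ̄ = ℓ`) complex conjugation ACTS on
`H¹(K_ℓ, T̄)`, `H¹_f(K_ℓ, T̄)`, `H¹_s(K_ℓ, T̄)` and «splits [them] each into one-dimensional eigenspaces».

THE POINT. In the tree the conjugation datum transports `H¹(K_{σ v}, T̄) → H¹(K_v, Tw T̄)`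
(`cd.transportH1 ρ̄ v`), and for an inert `q` the equality `σ • q = q` is PROPOSITIONAL, so the local
action of `τ` at `q` is the composite
`τ_q x := θ_* (transport_q (x cast along q = σ • q))`, the cast being `Eq.rec` along the place
datum `h : cd.σ • q = q`. This file supplies the cast bookkeeping once (generic in two places `v = w`,
proved by `subst`) and the two facts the parity assembler needs: **`τ_q ∘ loc_q = loc_q ∘ τ_*`**
(from `ResidualTau.localization_semilinearH`) and hence **global `ε`-eigenclasses localize to local
`ε`-eigenvectors of `τ_q`**.

WHAT IS PROVED.
* §1 (any discrete module `ρ`, places `v = w`): `cast_localization` (`h ▸ loc_v c = loc_w c`),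
  `cast_add`, `cast_neg`, `cast_zero`, `cast_eq_iff_eq_cast`, `mem_iff_cast_mem` (membership in a family of
  local conditions `𝓕 : SelmerStructure ρ` is invariant under the cast).
* §2 (Howard's residual data `cd`, `A : ResidualTau cd ρbar`, inert `q`):
  **`ResidualTau.thetaH1_transportH1_cast_localization`**:
  `θ_* (transport_q (h.symm ▸ loc_q c)) = loc_q (τ_* c)`; **`…_of_semilinearH_eq`** /
  **`…_of_semilinearH_eq_neg`**: if `τ_* c = c` (resp. `= -c`) then `τ_q (loc_q c) = loc_q c`
  (resp. `= -loc_q c`); `τ_q` is additive (`thetaH1_transportH1_cast_add`).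

NOT HERE: `τ_q² = 1`, `τ_q`-stability of `H¹_f`/`H¹_tr`, the eigenLINES (Prop. 1.1.7 + H.5(a)), the
splitting `H¹ = H¹_f ⊕ H¹_tr`; `thm161_dvrKolyvaginBound` is NOT proved; no summit statement is proved;
the Birch–Swinnerton-Dyer conjecture is not proved by any of this.
References: [Howard2004HeegnerKolyvagin] §1.3 (p. 7 L44–48), Lemma 1.5.3 (p. 10 L12–40).
-/

set_option autoImplicit false

noncomputable section

open Function NumberField IsDedekindDomain Field
open scoped NumberField

namespace Literature.NumberTheory.GaloisCohomology.Howard2004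

open Literature.NumberTheory.GaloisRepresentations
open Literature.NumberTheory.GaloisRepresentations.DiscreteGaloisModule
open Literature.NumberTheory.EllipticCurves

variable {K : Type} [Field K] [NumberField K] {M : Type} [AddCommGroup M] [TopologicalSpace M]
  [DiscreteTopology M]

/-! ## §1 Casting local classes along an equality of finite places -/

section Cast

variable (ρ : DiscreteGaloisModule K M)

/-- `h ▸ loc_v c = loc_w c` for `h : v = w` (place-datum bookkeeping for an inert prime `σ • q = q`).
[cite: Howard2004HeegnerKolyvagin, §1.3 (arXiv p. 7 L44–48: «`v̄ = v^τ`», read at a degree-two prime `λ̄ = λ`, §1.2 p. 6 L54–56)] -/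
theorem cast_localization {v w : HeightOneSpectrum (𝓞 K)} (h : v = w) (c : galoisCohomology ρ 1) :
    (h ▸ galoisCohomology.localization ρ (Sum.inr v) 1 c :
        galoisCohomology (ρ.toLocal (Sum.inr w)) 1) =
      galoisCohomology.localization ρ (Sum.inr w) 1 c := by
  subst h
  rfl

/-- The cast along `v = w` is additive. [cite: Howard2004HeegnerKolyvagin, §1.3 (arXiv p. 7 L44–48: «`v̄ = v^τ`», read at a degree-two prime `λ̄ = λ`, §1.2 p. 6 L54–56)] -/
theorem cast_add {v w : HeightOneSpectrum (𝓞 K)} (h : v = w)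
    (x y : galoisCohomology (ρ.toLocal (Sum.inr v)) 1) :
    (h ▸ (x + y) : galoisCohomology (ρ.toLocal (Sum.inr w)) 1) =
      (h ▸ x : galoisCohomology (ρ.toLocal (Sum.inr w)) 1) + (h ▸ y : _) := by
  subst h
  rfl

/-- The cast along `v = w` commutes with negation. [cite: Howard2004HeegnerKolyvagin, §1.3 (arXiv p. 7 L44–48: «`v̄ = v^τ`», read at a degree-two prime `λ̄ = λ`, §1.2 p. 6 L54–56)] -/
theorem cast_neg {v w : HeightOneSpectrum (𝓞 K)} (h : v = w)
    (x : galoisCohomology (ρ.toLocal (Sum.inr v)) 1) :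
    (h ▸ (-x) : galoisCohomology (ρ.toLocal (Sum.inr w)) 1) =
      -(h ▸ x : galoisCohomology (ρ.toLocal (Sum.inr w)) 1) := by
  subst h
  rfl

/-- The cast along `v = w` of `0` is `0`. [cite: Howard2004HeegnerKolyvagin, §1.3 (arXiv p. 7 L44–48: «`v̄ = v^τ`», read at a degree-two prime `λ̄ = λ`, §1.2 p. 6 L54–56)] -/
theorem cast_zero {v w : HeightOneSpectrum (𝓞 K)} (h : v = w) :
    (h ▸ (0 : galoisCohomology (ρ.toLocal (Sum.inr v)) 1) :
      galoisCohomology (ρ.toLocal (Sum.inr w)) 1) = 0 := by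
  subst h
  rfl

/-- Round trip of the casts: `h.symm ▸ (h ▸ x) = x`. [cite: Howard2004HeegnerKolyvagin, §1.3 (arXiv p. 7 L44–48: «`v̄ = v^τ`», read at a degree-two prime `λ̄ = λ`, §1.2 p. 6 L54–56)] -/
theorem cast_symm_cast {v w : HeightOneSpectrum (𝓞 K)} (h : v = w)
    (x : galoisCohomology (ρ.toLocal (Sum.inr v)) 1) :
    (h.symm ▸ (h ▸ x : galoisCohomology (ρ.toLocal (Sum.inr w)) 1) :
      galoisCohomology (ρ.toLocal (Sum.inr v)) 1) = x := by
  subst h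
  rfl

/-- Membership in a family of local conditions (`SelmerStructure`) is invariant under the cast along
`v = w`. [cite: Howard2004HeegnerKolyvagin, §1.3 (arXiv p. 7 L44–48: «`v̄ = v^τ`», read at a degree-two prime `λ̄ = λ`, §1.2 p. 6 L54–56)] -/
theorem cast_mem_iff {v w : HeightOneSpectrum (𝓞 K)} (h : v = w) (𝓕 : SelmerStructure ρ)
    (x : galoisCohomology (ρ.toLocal (Sum.inr v)) 1) :
    (h ▸ x : galoisCohomology (ρ.toLocal (Sum.inr w)) 1) ∈ 𝓕 (Sum.inr w) ↔ x ∈ 𝓕 (Sum.inr v) := by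
  subst h
  exact Iff.rfl

end Cast

/-! ## §2 `τ_q ∘ loc_q = loc_q ∘ τ_*` at an inert `q`, and eigenclasses -/

namespace ResidualTau

variable {Nbar : Type} [AddCommGroup Nbar] [TopologicalSpace Nbar] [DiscreteTopology Nbar]
  {R : Type} [CommRing R] [Module R Nbar] {cd : ConjugationDatum K} {ρbar : DiscreteGaloisModule K Nbar}

/-- **`τ_q ∘ loc_q = loc_q ∘ τ_*` at an inert prime** (`h : σ • q = q`): the local action
`τ_q x = θ_* (transport_q (h.symm ▸ x))` on `H¹(K_q, T̄)` applied to `loc_q c` is `loc_q (τ_* c)`.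
[cite: Howard2004HeegnerKolyvagin, §1.3 (arXiv p. 7 L44–48) and Lemma 1.5.3 (p. 10 L12–16)] -/
theorem thetaH1_transportH1_cast_localization (A : ResidualTau (R := R) cd ρbar)
    {q : HeightOneSpectrum (𝓞 K)} (h : cd.σ • q = q) (c : galoisCohomology ρbar 1) :
    A.thetaH1 (Sum.inr q) (cd.transportH1 ρbar q
        (h.symm ▸ galoisCohomology.localization ρbar (Sum.inr q) 1 c :
          galoisCohomology (ρbar.toLocal (Sum.inr (cd.σ • q))) 1)) =
      galoisCohomology.localization ρbar (Sum.inr q) 1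
        (semilinearH cd.isLift A.θ.toAddMonoidHom A.isSemilinear 1 c) := by
  rw [cast_localization ρbar h.symm c, A.localization_semilinearH q c]

/-- **A global `τ`-fixed class localizes to a `τ_q`-fixed local class** at an inert `q`:
`τ_* c = c ⟹ τ_q (loc_q c) = loc_q c`. [cite: Howard2004HeegnerKolyvagin, Lemma 1.5.3 (arXiv p. 10 L12–16: «`H¹_{𝓕(n)}(K, T̄)^±` … `H¹_f(K_ℓ, T̄)^±`»)] -/
theorem thetaH1_transportH1_cast_localization_of_semilinearH_eq (A : ResidualTau (R := R) cd ρbar)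
    {q : HeightOneSpectrum (𝓞 K)} (h : cd.σ • q = q) {c : galoisCohomology ρbar 1}
    (hc : semilinearH cd.isLift A.θ.toAddMonoidHom A.isSemilinear 1 c = c) :
    A.thetaH1 (Sum.inr q) (cd.transportH1 ρbar q
        (h.symm ▸ galoisCohomology.localization ρbar (Sum.inr q) 1 c :
          galoisCohomology (ρbar.toLocal (Sum.inr (cd.σ • q))) 1)) =
      galoisCohomology.localization ρbar (Sum.inr q) 1 c := by
  rw [A.thetaH1_transportH1_cast_localization h c, hc]

/-- **A global `τ`-anti-fixed class localizes to a `τ_q`-anti-fixed local class** at an inert `q`: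
`τ_* c = -c ⟹ τ_q (loc_q c) = -loc_q c`. [cite: Howard2004HeegnerKolyvagin, Lemma 1.5.3 (arXiv p. 10 L12–16)] -/
theorem thetaH1_transportH1_cast_localization_of_semilinearH_eq_neg (A : ResidualTau (R := R) cd ρbar)
    {q : HeightOneSpectrum (𝓞 K)} (h : cd.σ • q = q) {c : galoisCohomology ρbar 1}
    (hc : semilinearH cd.isLift A.θ.toAddMonoidHom A.isSemilinear 1 c = -c) :
    A.thetaH1 (Sum.inr q) (cd.transportH1 ρbar q
        (h.symm ▸ galoisCohomology.localization ρbar (Sum.inr q) 1 c :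
          galoisCohomology (ρbar.toLocal (Sum.inr (cd.σ • q))) 1)) =
      -galoisCohomology.localization ρbar (Sum.inr q) 1 c := by
  rw [A.thetaH1_transportH1_cast_localization h c, hc, map_neg]

/-- `τ_q` is additive (the cast is additive and `θ_* ∘ transport_q` is a homomorphism).
[cite: Howard2004HeegnerKolyvagin, §1.3 (arXiv p. 7 L44–48)] -/
theorem thetaH1_transportH1_cast_add (A : ResidualTau (R := R) cd ρbar)
    {q : HeightOneSpectrum (𝓞 K)} (h : cd.σ • q = q)
    (x y : galoisCohomology (ρbar.toLocal (Sum.inr q)) 1) :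
    A.thetaH1 (Sum.inr q) (cd.transportH1 ρbar q
        (h.symm ▸ (x + y) : galoisCohomology (ρbar.toLocal (Sum.inr (cd.σ • q))) 1)) =
      A.thetaH1 (Sum.inr q) (cd.transportH1 ρbar q
          (h.symm ▸ x : galoisCohomology (ρbar.toLocal (Sum.inr (cd.σ • q))) 1)) +
        A.thetaH1 (Sum.inr q) (cd.transportH1 ρbar q
          (h.symm ▸ y : galoisCohomology (ρbar.toLocal (Sum.inr (cd.σ • q))) 1)) := by
  rw [cast_add ρbar h.symm x y, map_add, map_add]

end ResidualTau

end Literature.NumberTheory.GaloisCohomology.Howard2004
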